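import Mathlib.Analysis.Complex.JensenFormula
import Mathlib.Analysis.Calculus.Deriv.Star
import Literature.Analysis.Complex.ArgumentPrincipleRectangle
import HarnessLib

/-!
# Backlund's lemma: the variation of `arg g` along a segment via Jensen's formula

Trunk T-ANALYSIS support (complex analysis, `Literature/Analysis/Complex`). Leaf A2 of the
decomposition of `Literature.NumberTheory.LFunctions.speiser_iff` (Levinson–Montgomery 1974, proof of Thm. 1 (1.1): "by a
familiar argument based on Jensen's theorem [7, § 9.4], we find that arg ζ(σ+iT) and arg ζ'(σ+iT)
vary by at most O(log T) on the interval 0 ≤ σ ≤ 1").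

The "familiar argument" (Backlund 1918; Titchmarsh, *The Theory of the Riemann Zeta-Function*,
§9.4, proof of Thm. 9.4 for `ζ`, and in general form Titchmarsh, *Theory of Functions*, §3.61):
the variation of `arg g` along a horizontal segment `t = y`, `a ≤ x ≤ b` on which `g ≠ 0` is
`Im ∫_a^b g'/g (x+iy) dx`; if `Re g(x+iy)` vanishes at `q` points of the segment, the segment splits
into `q+1` pieces on each of which `Re g` has constant sign, so that on each piece `arg g` varies
by at most `π`: `|Im ∫_a^b g'/g| ≤ (q+1)π`. And `q` is at most the number of zeros in the disc
`|z - c| ≤ r ⊇ [a,b]` of the analytic function `G(z) = ½ (g(z+iy) + conj g(z̄+iy))`, which equals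
`Re g(x+iy)` for real `z = x`; by Jensen's formula this is `≤ log(M/|G(c)|)/log(R/r)` if
`|G| ≤ M` on `|z-c| ≤ R`.

## Main results (all proved)

* `Literature.Analysis.Complex.abs_im_integral_logDeriv_le_pi_of_re_sign` — one piece: `Re g ≥ 0` (or `≤ 0`)
  and `g ≠ 0` on the segment give `|Im ∫ g'/g| ≤ π`.
* `Literature.Analysis.Complex.abs_im_integral_logDeriv_le_of_finset` — Backlund's splitting: if the zeros of
  `x ↦ Re g(x+iy)` in `(a,b)` lie in a finite set `Z`, then `|Im ∫_a^b g'/g| ≤ π (#Z + 1)`.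
* `Literature.Complex.backlundAux g y` — the auxiliary function `G`; `backlundAux_ofReal`,
  `analyticAt_backlundAux`, `norm_backlundAux_le`.
* `Literature.Analysis.Complex.card_zeros_re_le_jensen` — Jensen's bound for the number of zeros of `Re g` on
  `[c-r, c+r] × {y}`; `Literature.Analysis.Complex.finite_zeros_re` — there are finitely many.
* `Literature.Analysis.Complex.abs_im_integral_logDeriv_le_backlund` — **Backlund's lemma**: for `g` analytic on
  `|z - (c+iy)| ≤ R` with `|g| ≤ M` there (`M ≥ 1`), `g(c+iy) ≠ 0`, `0 < r < R`,
  `[a,b] ⊆ [c-r,c+r]` and `g ≠ 0` on `[a,b] × {y}`,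
  `|Im ∫_a^b g'/g (x+iy) dx| ≤ π (log(M/|g(c+iy)|)/log(R/r) + 1)`
  (the rotation `g ↦ \overline{g(c+iy)} g` reduces to `Re g(c+iy) ≠ 0`).

## References

* E. C. Titchmarsh, *The Theory of the Riemann Zeta-Function*, 2nd ed. (rev. D. R. Heath-Brown),
  OUP 1986, §9.4 (proof of Thm. 9.4: bound for `S(T)` via Jensen).
* E. C. Titchmarsh, *The Theory of Functions*, 2nd ed., OUP 1939, §3.61 (Jensen's theorem).
* R. J. Backlund, *Über die Nullstellen der Riemannschen Zetafunktion*, Acta Math. 41 (1918),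
  345–375.
* N. Levinson, H. L. Montgomery, *Zeros of the derivatives of the Riemann zeta-function*, Acta
  Math. 133 (1974), 49–65, §2.
-/

noncomputable section

open Complex Set MeasureTheory Filter Topology intervalIntegral Metric MeromorphicOn
open scoped Real

namespace Literature.Analysis.Complex

variable {a b : ℝ}

/-! ### One piece: values in a closed half-plane -/

/-- If `g` is analytic and non-zero at every point of the horizontal segment `[a,b] × {y}` and
`Re g ≥ 0` there, then `|Im ∫_a^b g'/g (x+iy) dx| ≤ π`: the principal logarithm is a primitive and
both arguments lie in `[-π/2, π/2]`. [cite: Titchmarsh1986, §9.4] -/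
theorem abs_im_integral_logDeriv_le_pi_of_re_nonneg {g : ℂ → ℂ} (y : ℝ) (hab : a ≤ b)
    (hg : ∀ x ∈ Icc a b, AnalyticAt ℂ g (x + y * I))
    (h0 : ∀ x ∈ Icc a b, g (x + y * I) ≠ 0)
    (hre : ∀ x ∈ Icc a b, 0 ≤ (g (x + y * I)).re) :
    |(∫ x : ℝ in a..b, deriv g (x + y * I) / g (x + y * I)).im| ≤ π := by
  have hs : ∀ x ∈ Icc a b, g (x + y * I) ∈ slitPlane := by
    intro x hx
    rw [mem_slitPlane_iff]
    rcases (hre x hx).eq_or_lt with h | h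
    · right
      intro him
      exact h0 x hx (Complex.ext (by simpa using h.symm) (by simpa using him))
    · exact Or.inl h
  rw [integral_logDeriv_horizontal y hab hg hs, sub_im, log_im, log_im]
  have h1 := abs_arg_le_pi_div_two_iff.2 (hre b ⟨hab, le_rfl⟩)
  have h2 := abs_arg_le_pi_div_two_iff.2 (hre a ⟨le_rfl, hab⟩)
  rw [abs_le] at h1 h2 ⊢
  constructor <;> linarith [h1.1, h1.2, h2.1, h2.2]

/-- The logarithmic derivative is unchanged by a non-zero constant factor. [folklore] -/
lemma deriv_const_mul_div_self {g : ℂ → ℂ} (e : ℂ) (he : e ≠ 0) (z : ℂ) :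
    deriv (fun w ↦ e * g w) z / (e * g z) = deriv g z / g z := by
  by_cases hg : DifferentiableAt ℂ g z
  · rw [deriv_const_mul _ hg, mul_div_mul_left _ _ he]
  · have : ¬ DifferentiableAt ℂ (fun w ↦ e * g w) z := by
      intro h
      exact hg (by simpa [he] using h.const_mul e⁻¹)
    rw [deriv_zero_of_not_differentiableAt hg, deriv_zero_of_not_differentiableAt this,
      zero_div, zero_div]

/-- One piece of Backlund's splitting: if `g` is analytic and non-zero on `[a,b] × {y}` and
`Re g` has constant sign there (`≥ 0` throughout or `≤ 0` throughout), then
`|Im ∫_a^b g'/g (x+iy) dx| ≤ π`. [cite: Titchmarsh1986, §9.4] -/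
theorem abs_im_integral_logDeriv_le_pi_of_re_sign {g : ℂ → ℂ} (y : ℝ) (hab : a ≤ b)
    (hg : ∀ x ∈ Icc a b, AnalyticAt ℂ g (x + y * I))
    (h0 : ∀ x ∈ Icc a b, g (x + y * I) ≠ 0)
    (hre : (∀ x ∈ Icc a b, 0 ≤ (g (x + y * I)).re) ∨ (∀ x ∈ Icc a b, (g (x + y * I)).re ≤ 0)) :
    |(∫ x : ℝ in a..b, deriv g (x + y * I) / g (x + y * I)).im| ≤ π := by
  rcases hre with hre | hre
  · exact abs_im_integral_logDeriv_le_pi_of_re_nonneg y hab hg h0 hre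
  · -- apply the previous case to `-g`
    have key : ∀ x ∈ Icc a b, deriv (fun w ↦ (-1 : ℂ) * g w) (x + y * I) / ((-1 : ℂ) * g (x + y * I))
        = deriv g (x + y * I) / g (x + y * I) := fun x _ ↦
      deriv_const_mul_div_self (-1) (by norm_num) _
    have h := abs_im_integral_logDeriv_le_pi_of_re_nonneg (g := fun w ↦ (-1 : ℂ) * g w) y hab
      (fun x hx ↦ analyticAt_const.mul (hg x hx)) (fun x hx ↦ by simpa using h0 x hx)
      (fun x hx ↦ by simpa using hre x hx)
    rwa [intervalIntegral.integral_congr (fun x hx ↦ key x (by rwa [uIcc_of_le hab] at hx))] at h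

/-! ### Constant sign between consecutive zeros -/

/-- A continuous real function on `[a,b]` without zeros in `(a,b)` has constant sign on `[a,b]`
(intermediate value theorem). [folklore] -/
lemma sign_const_of_no_zero_Ioo {φ : ℝ → ℝ} (hφ : ContinuousOn φ (Icc a b))
    (hz : ∀ x ∈ Ioo a b, φ x ≠ 0) :
    (∀ x ∈ Icc a b, 0 ≤ φ x) ∨ (∀ x ∈ Icc a b, φ x ≤ 0) := by
  by_contra h
  push Not at h
  obtain ⟨⟨x₁, hx₁, h₁⟩, ⟨x₂, hx₂, h₂⟩⟩ := h
  have hsub : uIcc x₁ x₂ ⊆ Icc a b := uIcc_subset_Icc hx₁ hx₂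
  have hcont : ContinuousOn φ (uIcc x₁ x₂) := hφ.mono hsub
  have h0mem : (0 : ℝ) ∈ uIcc (φ x₁) (φ x₂) := by
    rw [mem_uIcc]; exact Or.inl ⟨h₁.le, h₂.le⟩
  obtain ⟨x, hx, hx0⟩ := intermediate_value_uIcc hcont h0mem
  have hxa : x ≠ x₁ := by rintro rfl; exact h₁.ne hx0
  have hxb : x ≠ x₂ := by rintro rfl; exact h₂.ne' hx0
  refine hz x ?_ hx0
  rw [mem_uIcc] at hx
  rcases hx with ⟨hl, hr⟩ | ⟨hl, hr⟩
  · exact ⟨lt_of_le_of_lt hx₁.1 (lt_of_le_of_ne hl (Ne.symm hxa)),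
      lt_of_lt_of_le (lt_of_le_of_ne hr hxb) hx₂.2⟩
  · exact ⟨lt_of_le_of_lt hx₂.1 (lt_of_le_of_ne hl (Ne.symm hxb)),
      lt_of_lt_of_le (lt_of_le_of_ne hr hxa) hx₁.2⟩

/-- The real part of `g` along the segment is continuous. [folklore] -/
lemma continuousOn_re_horizontal {g : ℂ → ℂ} (y : ℝ)
    (hg : ∀ x ∈ Icc a b, AnalyticAt ℂ g (x + y * I)) :
    ContinuousOn (fun x : ℝ ↦ (g (x + y * I)).re) (Icc a b) := by
  intro x hx
  have h1 : ContinuousAt (fun x : ℝ ↦ (x : ℂ) + y * I) x := by fun_prop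
  have h2 : ContinuousAt g ((x : ℂ) + y * I) := (hg x hx).continuousAt
  exact (Complex.continuous_re.continuousAt.comp
    (h2.comp (f := fun x : ℝ ↦ (x : ℂ) + y * I) h1)).continuousWithinAt

/-! ### Backlund's splitting at the zeros of `Re g` -/

/-- **Backlund's splitting.** If `g` is analytic and non-zero on `[a,b] × {y}` and the zeros of
`x ↦ Re g(x+iy)` in `(a,b)` all belong to the finite set `Z`, then
`|Im ∫_a^b g'/g (x+iy) dx| ≤ π (#Z + 1)`: split the segment at the points of `Z`; on each piece
`Re g` keeps a constant sign. [cite: Titchmarsh1986, §9.4] -/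
theorem abs_im_integral_logDeriv_le_of_finset {g : ℂ → ℂ} (y : ℝ) :
    ∀ (N : ℕ) {a b : ℝ} (Z : Finset ℝ), Z.card ≤ N → a ≤ b →
      (∀ x ∈ Icc a b, AnalyticAt ℂ g (x + y * I)) → (∀ x ∈ Icc a b, g (x + y * I) ≠ 0) →
      (∀ x ∈ Ioo a b, (g (x + y * I)).re = 0 → x ∈ Z) →
      |(∫ x : ℝ in a..b, deriv g (x + y * I) / g (x + y * I)).im| ≤ π * (Z.card + 1) := by
  intro N
  induction N with
  | zero =>
    intro a b Z hZ hab hg h0 hzero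
    have hZe : Z = ∅ := Finset.card_eq_zero.1 (Nat.le_zero.1 hZ)
    subst hZe
    have hno : ∀ x ∈ Ioo a b, (g (x + y * I)).re ≠ 0 := fun x hx h ↦ by simpa using hzero x hx h
    have := abs_im_integral_logDeriv_le_pi_of_re_sign y hab hg h0
      (sign_const_of_no_zero_Ioo (continuousOn_re_horizontal y hg) hno)
    simpa using this
  | succ N ih =>
    intro a b Z hZ hab hg h0 hzero
    by_cases hm : ∃ m ∈ Z, m ∈ Ioo a b
    · obtain ⟨m, hmZ, hma, hmb⟩ := hm
      -- split at `m`
      set Z₁ := Z.filter (· < m) with hZ₁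
      set Z₂ := Z.filter (m < ·) with hZ₂
      have hdisj : Disjoint Z₁ Z₂ := by
        rw [hZ₁, hZ₂, Finset.disjoint_filter]
        intro x _ h1 h2
        exact lt_asymm h1 h2
      have hunion : Z₁ ∪ Z₂ ⊆ Z.erase m := by
        intro x hx
        rw [Finset.mem_union, hZ₁, hZ₂, Finset.mem_filter, Finset.mem_filter] at hx
        rw [Finset.mem_erase]
        rcases hx with ⟨h1, h2⟩ | ⟨h1, h2⟩
        · exact ⟨h2.ne, h1⟩
        · exact ⟨h2.ne', h1⟩
      have hcard : Z₁.card + Z₂.card ≤ Z.card - 1 := by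
        rw [← Finset.card_union_of_disjoint hdisj, ← Finset.card_erase_of_mem hmZ]
        exact Finset.card_le_card hunion
      have hZpos : 1 ≤ Z.card := Finset.card_pos.2 ⟨m, hmZ⟩
      have hc₁ : Z₁.card ≤ N := by omega
      have hc₂ : Z₂.card ≤ N := by omega
      have hg₁ : ∀ x ∈ Icc a m, AnalyticAt ℂ g (x + y * I) := fun x hx ↦
        hg x ⟨hx.1, hx.2.trans hmb.le⟩
      have hg₂ : ∀ x ∈ Icc m b, AnalyticAt ℂ g (x + y * I) := fun x hx ↦
        hg x ⟨hma.le.trans hx.1, hx.2⟩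
      have h0₁ : ∀ x ∈ Icc a m, g (x + y * I) ≠ 0 := fun x hx ↦ h0 x ⟨hx.1, hx.2.trans hmb.le⟩
      have h0₂ : ∀ x ∈ Icc m b, g (x + y * I) ≠ 0 := fun x hx ↦ h0 x ⟨hma.le.trans hx.1, hx.2⟩
      have hz₁ : ∀ x ∈ Ioo a m, (g (x + y * I)).re = 0 → x ∈ Z₁ := fun x hx h ↦ by
        rw [hZ₁, Finset.mem_filter]
        exact ⟨hzero x ⟨hx.1, hx.2.trans hmb⟩ h, hx.2⟩
      have hz₂ : ∀ x ∈ Ioo m b, (g (x + y * I)).re = 0 → x ∈ Z₂ := fun x hx h ↦ by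
        rw [hZ₂, Finset.mem_filter]
        exact ⟨hzero x ⟨hma.trans hx.1, hx.2⟩ h, hx.1⟩
      have I₁ := ih Z₁ hc₁ hma.le hg₁ h0₁ hz₁
      have I₂ := ih Z₂ hc₂ hmb.le hg₂ h0₂ hz₂
      -- additivity of the integral
      have hint : ∀ {a' b' : ℝ}, a' ≤ b' → (∀ x ∈ Icc a' b', AnalyticAt ℂ g (x + y * I)) →
          (∀ x ∈ Icc a' b', g (x + y * I) ≠ 0) →
          IntervalIntegrable (fun x : ℝ ↦ deriv g (x + y * I) / g (x + y * I)) volume a' b' := by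
        intro a' b' hab' hg' h0'
        refine intervalIntegrable_of_continuousAt_horizontal (F := fun z ↦ deriv g z / g z) y hab' ?_
        intro x hx
        exact ((hg' x hx).deriv.continuousAt).div (hg' x hx).continuousAt (h0' x hx)
      rw [← integral_add_adjacent_intervals (hint hma.le hg₁ h0₁) (hint hmb.le hg₂ h0₂), add_im]
      calc |(∫ x : ℝ in a..m, deriv g (x + y * I) / g (x + y * I)).im +
            (∫ x : ℝ in m..b, deriv g (x + y * I) / g (x + y * I)).im|
          ≤ |(∫ x : ℝ in a..m, deriv g (x + y * I) / g (x + y * I)).im| +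
            |(∫ x : ℝ in m..b, deriv g (x + y * I) / g (x + y * I)).im| := abs_add_le _ _
        _ ≤ π * (Z₁.card + 1) + π * (Z₂.card + 1) := add_le_add I₁ I₂
        _ ≤ π * (Z.card + 1) := by
          have : (Z₁.card : ℝ) + Z₂.card + 1 ≤ Z.card := by
            have h : Z₁.card + Z₂.card + 1 ≤ Z.card := by omega
            exact_mod_cast h
          nlinarith [Real.pi_pos]
    · push Not at hm
      have hno : ∀ x ∈ Ioo a b, (g (x + y * I)).re ≠ 0 := fun x hx h ↦ hm x (hzero x hx h) hx
      have := abs_im_integral_logDeriv_le_pi_of_re_sign y hab hg h0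
        (sign_const_of_no_zero_Ioo (continuousOn_re_horizontal y hg) hno)
      calc _ ≤ π := this
        _ ≤ π * (Z.card + 1) := by
          have : (0 : ℝ) ≤ Z.card := Nat.cast_nonneg _
          nlinarith [Real.pi_pos]

/-! ### Backlund's auxiliary function `G(z) = ½ (g(z+iy) + \overline{g(z̄+iy)})` -/

open scoped ComplexConjugate

/-- Backlund's auxiliary function `G(z) = ½ (g(z + iy) + conj g(z̄ + iy))`: analytic where `g` is
(Schwarz reflection), and equal to `Re g(x+iy)` for real `z = x`.
[cite: Titchmarsh1986, §9.4] -/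
def backlundAux (g : ℂ → ℂ) (y : ℝ) (z : ℂ) : ℂ :=
  (g (z + y * I) + conj (g (conj z + y * I))) / 2

/-- On the real axis `G(x) = Re g(x + iy)`. [cite: Titchmarsh1986, §9.4] -/
lemma backlundAux_ofReal (g : ℂ → ℂ) (y x : ℝ) :
    backlundAux g y x = ((g (x + y * I)).re : ℂ) := by
  rw [backlundAux, Complex.conj_ofReal, Complex.re_eq_add_conj]

/-- `G(x) = 0` iff `Re g(x+iy) = 0`, for real `x`. [folklore] -/
lemma backlundAux_ofReal_eq_zero_iff (g : ℂ → ℂ) (y x : ℝ) :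
    backlundAux g y x = 0 ↔ (g (x + y * I)).re = 0 := by
  rw [backlundAux_ofReal, Complex.ofReal_eq_zero]

/-- The Schwarz reflection `z ↦ conj h(z̄)` of a function analytic at `z̄` is analytic at `z`.
[folklore] -/
lemma analyticAt_conj_comp_conj {h : ℂ → ℂ} {z : ℂ} (hh : AnalyticAt ℂ h (conj z)) :
    AnalyticAt ℂ (fun w ↦ conj (h (conj w))) z := by
  rw [analyticAt_iff_eventually_differentiableAt] at hh ⊢
  have ht : Tendsto (fun w : ℂ ↦ conj w) (𝓝 z) (𝓝 (conj z)) :=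
    Complex.continuous_conj.continuousAt.tendsto
  filter_upwards [ht.eventually hh] with w hw
  have := hw.conj_conj
  simpa [Function.comp_def] using this

/-- `G` is analytic at `z` if `g` is analytic at `z + iy` and at `z̄ + iy`.
[cite: Titchmarsh1986, §9.4] -/
lemma analyticAt_backlundAux {g : ℂ → ℂ} {y : ℝ} {z : ℂ} (h1 : AnalyticAt ℂ g (z + y * I))
    (h2 : AnalyticAt ℂ g (conj z + y * I)) : AnalyticAt ℂ (backlundAux g y) z := by
  have hA : AnalyticAt ℂ (fun w ↦ g (w + y * I)) z :=
    h1.comp (f := fun w : ℂ ↦ w + y * I) (analyticAt_id.add analyticAt_const)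
  have hB' : AnalyticAt ℂ (fun w ↦ g (w + y * I)) (conj z) :=
    h2.comp (f := fun w : ℂ ↦ w + y * I) (analyticAt_id.add analyticAt_const)
  have hB : AnalyticAt ℂ (fun w ↦ conj (g (conj w + y * I))) z :=
    analyticAt_conj_comp_conj (h := fun w ↦ g (w + y * I)) hB'
  have e : backlundAux g y = fun w ↦ (g (w + y * I) + conj (g (conj w + y * I))) * (2 : ℂ)⁻¹ := by
    funext w; simp [backlundAux, div_eq_mul_inv]
  rw [e]
  exact (hA.add hB).mul analyticAt_const

/-- `|G(z)| ≤ ½ (|g(z+iy)| + |g(z̄+iy)|)`. [folklore] -/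
lemma norm_backlundAux_le (g : ℂ → ℂ) (y : ℝ) (z : ℂ) :
    ‖backlundAux g y z‖ ≤ (‖g (z + y * I)‖ + ‖g (conj z + y * I)‖) / 2 := by
  rw [backlundAux, norm_div, Complex.norm_two, div_le_div_iff_of_pos_right two_pos]
  refine (norm_add_le _ _).trans ?_
  rw [Complex.norm_conj]

/-! ### Jensen's bound for the number of zeros of `Re g` on the segment -/

/-- Points of `[c-r, c+r]` (as complex numbers) lie in the closed disc `|z - c| ≤ r`. [folklore] -/
lemma ofReal_mem_closedBall_of_mem_Icc {c r x : ℝ} (hx : x ∈ Icc (c - r) (c + r)) :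
    (x : ℂ) ∈ closedBall (c : ℂ) r := by
  rw [mem_closedBall, dist_eq_norm, ← Complex.ofReal_sub, Complex.norm_real, Real.norm_eq_abs,
    abs_le]
  constructor <;> linarith [hx.1, hx.2]

/-- Translation of the disc: `|z - c| ≤ R` implies `|(z + iy) - (c + iy)| ≤ R` and
`|(z̄ + iy) - (c + iy)| ≤ R` (`c` real). [folklore] -/
lemma mem_closedBall_shift {c y R : ℝ} {z : ℂ} (hz : z ∈ closedBall (c : ℂ) R) :
    z + y * I ∈ closedBall ((c : ℂ) + y * I) R ∧ conj z + y * I ∈ closedBall ((c : ℂ) + y * I) R := by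
  rw [mem_closedBall, dist_eq_norm] at hz ⊢
  rw [mem_closedBall, dist_eq_norm]
  constructor
  · simpa using hz
  · have : conj z + y * I - ((c : ℂ) + y * I) = conj (z - c) := by
      simp [map_sub, Complex.conj_ofReal]
    rw [this, Complex.norm_conj]
    exact hz

/-- **Jensen's bound for the zeros of `Re g` on a segment.** Let `g` be analytic at every point of
the disc `|z - (c+iy)| ≤ R` with `|g| ≤ M` there (`M ≥ 1`), `Re g(c+iy) ≠ 0`, and `0 < r < R`.
Then any finite set `Z` of zeros of `x ↦ Re g(x+iy)` in `[c-r, c+r]` has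
`#Z ≤ log(M/|Re g(c+iy)|)/log(R/r)` (Jensen's formula for `G`, Mathlib's
`AnalyticOnNhd.sum_divisor_le`, each zero having multiplicity `≥ 1`). [cite: Titchmarsh1986, §9.4] -/
theorem card_zeros_re_le_jensen {g : ℂ → ℂ} {c y r R M : ℝ} (hr : 0 < r) (hrR : r < R)
    (hM : 1 ≤ M) (hg : ∀ z ∈ closedBall ((c : ℂ) + y * I) R, AnalyticAt ℂ g z)
    (hgM : ∀ z ∈ closedBall ((c : ℂ) + y * I) R, ‖g z‖ ≤ M) (hc : (g (c + y * I)).re ≠ 0)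
    (Z : Finset ℝ) (hZ : ∀ x ∈ Z, x ∈ Icc (c - r) (c + r) ∧ (g (x + y * I)).re = 0) :
    (Z.card : ℝ) ≤ Real.log (M / |(g (c + y * I)).re|) / Real.log (R / r) := by
  set G := backlundAux g y with hG
  have hR : 0 < R := hr.trans hrR
  -- `G` is analytic on the disc `|z - c| ≤ R`, bounded by `M`
  have hGan : AnalyticOnNhd ℂ G (closedBall (c : ℂ) |R|) := by
    intro z hz
    rw [abs_of_pos hR] at hz
    obtain ⟨h1, h2⟩ := mem_closedBall_shift (y := y) hz
    exact analyticAt_backlundAux (hg _ h1) (hg _ h2)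
  have hGM : ∀ z ∈ sphere (c : ℂ) |R|, ‖G z‖ ≤ M := by
    intro z hz
    rw [abs_of_pos hR] at hz
    obtain ⟨h1, h2⟩ := mem_closedBall_shift (y := y) (sphere_subset_closedBall hz)
    refine (norm_backlundAux_le g y z).trans ?_
    linarith [hgM _ h1, hgM _ h2]
  have hGc : G c = ((g (c + y * I)).re : ℂ) := backlundAux_ofReal g y c
  have hGc0 : G c ≠ 0 := by rw [hGc, Complex.ofReal_ne_zero]; exact hc
  have hnormGc : ‖G c‖ = |(g (c + y * I)).re| := by rw [hGc, Complex.norm_real, Real.norm_eq_abs]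
  -- Jensen
  have hJ := AnalyticOnNhd.sum_divisor_le (f := G) (c := (c : ℂ)) (r := r) (R := R)
    (by rwa [abs_of_pos hr]) (by rwa [abs_of_pos hr, abs_of_pos hR]) hM hGan hGc0 hGM
  rw [abs_of_pos hr, hnormGc] at hJ
  refine le_trans ?_ hJ
  -- each point of `Z` carries divisor `≥ 1`
  set U := closedBall (c : ℂ) r with hU
  have hGanU : AnalyticOnNhd ℂ G U := fun z hz ↦
    hGan z (by rw [abs_of_pos hR]; exact closedBall_subset_closedBall hrR.le hz)
  have hmer : MeromorphicOn G U := hGanU.meromorphicOn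
  set D := divisor G U with hD
  have hfin : (Function.support fun u ↦ (D u : ℝ)).Finite := by
    refine (D.finiteSupport (isCompact_closedBall _ _)).subset fun u hu ↦ ?_
    simpa using hu
  have hcast : ((∑ᶠ u, D u : ℤ) : ℝ) = ∑ᶠ u, (D u : ℝ) :=
    map_finsum (Int.castRingHom ℝ) (D.finiteSupport (isCompact_closedBall _ _))
  rw [hcast, finsum_eq_sum_of_support_subset _ (s := hfin.toFinset) (by simp)]
  -- the divisor at a real zero `x ∈ Z` is `≥ 1`
  have hDx : ∀ x ∈ Z, (1 : ℝ) ≤ D (x : ℂ) := by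
    intro x hx
    obtain ⟨hxI, hx0⟩ := hZ x hx
    have hxU : (x : ℂ) ∈ U := ofReal_mem_closedBall_of_mem_Icc hxI
    have hGx : G x = 0 := (backlundAux_ofReal_eq_zero_iff g y x).2 hx0
    rw [hD, divisor_apply hmer hxU]
    -- analytic, not locally zero (identity theorem from `G c ≠ 0` on the preconnected disc)
    have han : AnalyticAt ℂ G x := hGanU x hxU
    have hne_top : analyticOrderAt G x ≠ ⊤ := by
      intro htop
      rw [analyticOrderAt_eq_top] at htop
      have hpre : IsPreconnected U := (convex_closedBall (c : ℂ) r).isPreconnected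
      have hcU : (c : ℂ) ∈ U := mem_closedBall_self hr.le
      have := hGanU.eqOn_zero_of_preconnected_of_eventuallyEq_zero hpre hxU htop hcU
      exact hGc0 this
    have hpos : 0 < analyticOrderAt G x := by
      rw [pos_iff_ne_zero, Ne, han.analyticOrderAt_eq_zero]
      exact not_not.2 hGx
    obtain ⟨n, hn⟩ := ENat.ne_top_iff_exists.mp hne_top
    rw [← hn] at hpos
    have hn1 : 1 ≤ n := Nat.one_le_iff_ne_zero.2 (by rintro rfl; simp at hpos)
    rw [han.meromorphicOrderAt_eq, ← hn, ENat.map_coe, WithTop.untop₀_coe]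
    exact_mod_cast hn1
  -- compare the sums
  have hsub : Z.image (fun x : ℝ ↦ (x : ℂ)) ⊆ hfin.toFinset := by
    intro u hu
    rw [Finset.mem_image] at hu
    obtain ⟨x, hx, rfl⟩ := hu
    rw [Set.Finite.mem_toFinset, Function.mem_support]
    linarith [hDx x hx]
  have hinj : Set.InjOn (fun x : ℝ ↦ (x : ℂ)) Z := fun x _ x' _ h ↦ Complex.ofReal_injective h
  calc (Z.card : ℝ) = ∑ x ∈ Z, (1 : ℝ) := by simp
    _ ≤ ∑ x ∈ Z, (D (x : ℂ) : ℝ) := Finset.sum_le_sum hDx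
    _ = ∑ u ∈ Z.image (fun x : ℝ ↦ (x : ℂ)), (D u : ℝ) :=
        (Finset.sum_image (f := fun u : ℂ ↦ (D u : ℝ)) hinj).symm
    _ ≤ ∑ u ∈ hfin.toFinset, (D u : ℝ) :=
        Finset.sum_le_sum_of_subset_of_nonneg hsub fun u _ _ ↦ by
          exact_mod_cast hGanU.divisor_nonneg u

/-- The zeros of `x ↦ Re g(x+iy)` on `[c-r, c+r]` form a finite set (under the hypotheses of
`card_zeros_re_le_jensen`: they are zeros of the analytic `G ≢ 0` in a compact disc). [folklore] -/
theorem finite_zeros_re {g : ℂ → ℂ} {c y r R : ℝ} (hr : 0 < r) (hrR : r < R)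
    (hg : ∀ z ∈ closedBall ((c : ℂ) + y * I) R, AnalyticAt ℂ g z) (hc : (g (c + y * I)).re ≠ 0) :
    {x : ℝ | x ∈ Icc (c - r) (c + r) ∧ (g (x + y * I)).re = 0}.Finite := by
  by_contra hinf
  -- an infinite set of zeros would contain more than the Jensen bound allows
  set B : ℝ := Real.log ((max 1 (sSup ((fun z ↦ ‖g z‖) '' closedBall ((c : ℂ) + y * I) R))) /
    |(g (c + y * I)).re|) / Real.log (R / r) with hB
  obtain ⟨n, hn⟩ := exists_nat_gt B
  obtain ⟨Z, hZsub, hZcard⟩ := Set.Infinite.exists_subset_card_eq (Set.not_finite.1 hinf) n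
  -- bound `‖g‖` on the compact disc
  have hcont : ContinuousOn g (closedBall ((c : ℂ) + y * I) R) := fun z hz ↦
    (hg z hz).continuousAt.continuousWithinAt
  have hbdd : BddAbove ((fun z ↦ ‖g z‖) '' closedBall ((c : ℂ) + y * I) R) :=
    ((isCompact_closedBall _ _).image_of_continuousOn hcont.norm).bddAbove
  set M := max 1 (sSup ((fun z ↦ ‖g z‖) '' closedBall ((c : ℂ) + y * I) R)) with hM
  have hgM : ∀ z ∈ closedBall ((c : ℂ) + y * I) R, ‖g z‖ ≤ M := fun z hz ↦
    (le_csSup hbdd ⟨z, hz, rfl⟩).trans (le_max_right _ _)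
  have h := card_zeros_re_le_jensen hr hrR (le_max_left _ _) hg hgM hc Z
    (fun x hx ↦ by simpa using hZsub hx)
  rw [hZcard, ← hB] at h
  linarith

/-! ### Backlund's lemma -/

/-- **Backlund's lemma** (Titchmarsh 1986, §9.4; Levinson–Montgomery 1974, §2: "arg ζ(σ+iT) and
arg ζ'(σ+iT) vary by at most O(log T) on 0 ≤ σ ≤ 1 … by a familiar argument based on Jensen's
theorem"). Let `g` be analytic at every point of the disc `|z - (c+iy)| ≤ R`, with `|g| ≤ M` there
(`M ≥ 1`) and `g(c+iy) ≠ 0`; let `0 < r < R` and `[a,b] ⊆ [c-r, c+r]` with `g ≠ 0` on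
`[a,b] × {y}`. Then the variation of the argument of `g` along `[a,b] × {y}` satisfies
`|Im ∫_a^b g'/g (x+iy) dx| ≤ π (log(M/|g(c+iy)|)/log(R/r) + 1)`.
(Replace `g` by `\overline{g(c+iy)} g/|g(c+iy)|`, which has the same logarithmic derivative and
real part `|g(c+iy)| > 0` at the centre; then combine `abs_im_integral_logDeriv_le_of_finset` and
`card_zeros_re_le_jensen`.) [cite: Titchmarsh1986, §9.4] -/
theorem abs_im_integral_logDeriv_le_backlund {g : ℂ → ℂ} {c y r R M a b : ℝ} (hr : 0 < r)
    (hrR : r < R) (hM : 1 ≤ M) (hg : ∀ z ∈ closedBall ((c : ℂ) + y * I) R, AnalyticAt ℂ g z)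
    (hgM : ∀ z ∈ closedBall ((c : ℂ) + y * I) R, ‖g z‖ ≤ M) (hc : g (c + y * I) ≠ 0)
    (hab : a ≤ b) (ha : c - r ≤ a) (hb : b ≤ c + r) (h0 : ∀ x ∈ Icc a b, g (x + y * I) ≠ 0) :
    |(∫ x : ℝ in a..b, deriv g (x + y * I) / g (x + y * I)).im| ≤
      π * (Real.log (M / ‖g (c + y * I)‖) / Real.log (R / r) + 1) := by
  set w₀ := g (c + y * I) with hw₀
  have hw₀n : (‖w₀‖ : ℂ) ≠ 0 := by exact_mod_cast norm_ne_zero_iff.2 hc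
  set e : ℂ := conj w₀ / ‖w₀‖ with he
  have he1 : ‖e‖ = 1 := by
    rw [he, norm_div, Complex.norm_conj, Complex.norm_real, Real.norm_eq_abs, abs_norm,
      div_self (norm_ne_zero_iff.2 hc)]
  have he0 : e ≠ 0 := norm_ne_zero_iff.1 (by rw [he1]; exact one_ne_zero)
  have hew : e * w₀ = (‖w₀‖ : ℂ) := by
    rw [he, div_mul_eq_mul_div, Complex.conj_mul', pow_two, mul_div_assoc, div_self hw₀n, mul_one]
  set g₁ : ℂ → ℂ := fun z ↦ e * g z with hg₁
  -- the segment lies in the disc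
  have hseg : ∀ x ∈ Icc a b, (x : ℂ) + y * I ∈ closedBall ((c : ℂ) + y * I) R := by
    intro x hx
    have h1 : (x : ℂ) ∈ closedBall (c : ℂ) R := by
      apply closedBall_subset_closedBall hrR.le
      exact ofReal_mem_closedBall_of_mem_Icc ⟨by linarith [hx.1], by linarith [hx.2]⟩
    exact (mem_closedBall_shift (y := y) h1).1
  have hg₁an : ∀ z ∈ closedBall ((c : ℂ) + y * I) R, AnalyticAt ℂ g₁ z := fun z hz ↦
    analyticAt_const.mul (hg z hz)
  have hg₁M : ∀ z ∈ closedBall ((c : ℂ) + y * I) R, ‖g₁ z‖ ≤ M := fun z hz ↦ by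
    rw [hg₁, norm_mul, he1, one_mul]; exact hgM z hz
  have hg₁c : g₁ (c + y * I) = (‖w₀‖ : ℂ) := hew
  have hg₁re : (g₁ (c + y * I)).re = ‖w₀‖ := by rw [hg₁c, Complex.ofReal_re]
  have hg₁re0 : (g₁ (c + y * I)).re ≠ 0 := by rw [hg₁re]; exact norm_ne_zero_iff.2 hc
  have hg₁seg : ∀ x ∈ Icc a b, AnalyticAt ℂ g₁ (x + y * I) := fun x hx ↦ hg₁an _ (hseg x hx)
  have hg₁0 : ∀ x ∈ Icc a b, g₁ (x + y * I) ≠ 0 := fun x hx ↦ mul_ne_zero he0 (h0 x hx)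
  -- the finite set of zeros of `Re g₁` on `[c-r, c+r]`
  have hfin := finite_zeros_re hr hrR hg₁an hg₁re0
  set Z := hfin.toFinset with hZ
  have hzero : ∀ x ∈ Ioo a b, (g₁ (x + y * I)).re = 0 → x ∈ Z := fun x hx h ↦ by
    rw [hZ, Set.Finite.mem_toFinset]
    exact ⟨⟨by linarith [hx.1], by linarith [hx.2]⟩, h⟩
  have hZmem : ∀ x ∈ Z, x ∈ Icc (c - r) (c + r) ∧ (g₁ (x + y * I)).re = 0 := fun x hx ↦ by
    rwa [hZ, Set.Finite.mem_toFinset] at hx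
  -- splitting and Jensen
  have h1 := abs_im_integral_logDeriv_le_of_finset (g := g₁) y Z.card Z le_rfl hab hg₁seg hg₁0 hzero
  have h2 := card_zeros_re_le_jensen hr hrR hM hg₁an hg₁M hg₁re0 Z hZmem
  rw [hg₁re, abs_norm] at h2
  have key : ∀ x ∈ Icc a b, deriv g₁ (x + y * I) / g₁ (x + y * I) =
      deriv g (x + y * I) / g (x + y * I) := fun x _ ↦ deriv_const_mul_div_self e he0 _
  rw [intervalIntegral.integral_congr (fun x hx ↦ key x (by rwa [uIcc_of_le hab] at hx))] at h1
  calc _ ≤ π * (Z.card + 1) := h1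
    _ ≤ π * (Real.log (M / ‖w₀‖) / Real.log (R / r) + 1) := by
        gcongr

end Literature.Analysis.Complex

end
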